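import Summits.Ventures.PercRepro.C041ZoneOCubeDefs

/-!
# The ZONE O-CUBE for ONE ANCHOR — the three kinds of admissible states (p6, gen 28; mine-3's C-041.md §15 (a))

Setting of `C041ZoneOCubeDefs`, plain case (`Q = ∅`, no protected anchor), a SINGLE anchor `k`.  The anchor's
SUB-ZONE is its blue reach `C = P {k} σ`; the anchor is deleted iff `C` carries a blocker (`mem_D_iff_inter`),
deleted on side `2` iff `C` carries a blue `2`-edge (`mem_D2_iff_inter`), and in an admissible state not both
(`not_mem_D_of_mem_D2`).  So an admissible state is of exactly one of three kinds — TYPE 1 (`k ∈ D`, the sub-zone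
carries a blue `1`-edge, `T1set`), TYPE 2 (`k ∈ D2`, `T2set`), ALL RED (`Fset`) — and `#adm = #F + #T₁ + #T₂`
(`card_Aset_eq_count`); the valid and the invalid admissible states (`Vset`, `Iset`) add up to `#adm`
(`card_Vset_add_card_Iset`).  Also the sets `G1set` / `G2set` (admissible with `G1` / `G2`) and `Xset` (the
intermediate set of the first involution of `C041ZoneOCubeCount`), the generic facts `mem_reach_iff_inter_nonempty`,
`reach_singleton_subset`, `card_eq_of_involutive` (two finite sets exchanged by an involution are equinumerous), and
admissibility read on side `2`: `adm ⟺ Disjoint Bl D2` (`adm_iff_disjoint_Bl_D2`).  The COUNT FORM itself is the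
next module.
-/

namespace PercRepro

namespace ZoneZ

namespace ZoneData

open Finset

variable {V E T₁ T₂ : Type*}

/-! ## Generic reach facts -/

/-- Along a symmetric adjacency, `v` is reached from `S` iff the reach of `v` meets `S`. -/
theorem mem_reach_iff_inter_nonempty {R : V → V → Prop} (hR : ∀ x y, R x y → R y x) {S : Set V} {v : V} :
    v ∈ reach R S ↔ (reach R {v} ∩ S).Nonempty := by
  constructor
  · intro h
    obtain ⟨s, hs, hsv⟩ := exists_mem_reach_of_mem_reach hR h
    exact ⟨s, hsv, hs⟩
  · rintro ⟨s, hsv, hs⟩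
    exact reach_mono (fun _ _ h => h) (Set.singleton_subset_iff.2 hs) (mem_reach_singleton_symm hR hsv)

/-- The reach of a reached vertex lies in the reach. -/
theorem reach_singleton_subset {R : V → V → Prop} {S : Set V} {v : V} (hv : v ∈ reach R S) :
    reach R {v} ⊆ reach R S := by
  rintro w ⟨s, hs, hsw⟩
  rw [Set.mem_singleton_iff] at hs
  subst hs
  exact reach_trans hv hsw

/-- Two finite sets exchanged by an involution have the same cardinality. -/
theorem card_eq_of_involutive {α : Type*} {s t : Finset α} (f : α → α) (hf : ∀ x, f (f x) = x)
    (hst : ∀ x ∈ s, f x ∈ t) (hts : ∀ x ∈ t, f x ∈ s) : #s = #t := by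
  apply le_antisymm
  · refine Finset.card_le_card_of_injOn f ?_ fun x _ y _ h => injective_of_involutive f hf h
    intro x hx
    rw [Finset.mem_coe] at hx ⊢
    exact hst x hx
  · refine Finset.card_le_card_of_injOn f ?_ fun x _ y _ h => injective_of_involutive f hf h
    intro x hx
    rw [Finset.mem_coe] at hx ⊢
    exact hts x hx

variable (Z : ZoneData V E T₁ T₂) (k : V)

/-! ## The anchor's sub-zone and the three kinds of admissible states -/

/-- The anchor is deleted iff its sub-zone carries a blocker (a blue `1`-edge). -/
theorem mem_D_iff_inter (σ : State E T₁ T₂) : k ∈ Z.D σ ↔ (Z.P {k} σ ∩ Z.Bl σ).Nonempty :=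
  mem_reach_iff_inter_nonempty (Z.adj_symm _ σ)

/-- The anchor is deleted on side `2` iff its sub-zone carries a blue `2`-edge. -/
theorem mem_D2_iff_inter (σ : State E T₁ T₂) : k ∈ Z.D2 σ ↔ (Z.P {k} σ ∩ Z.M σ).Nonempty :=
  mem_reach_iff_inter_nonempty (Z.adj_symm _ σ)

/-- The sub-zone of a non-deleted anchor misses the deleted vertices. -/
theorem disjoint_P_D_of_not_mem (σ : State E T₁ T₂) (hk : k ∉ Z.D σ) : Disjoint (Z.P {k} σ) (Z.D σ) := by
  rw [Set.disjoint_left]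
  intro v hvP hvD
  exact hk (reach_singleton_subset hvD (mem_reach_singleton_symm (Z.adj_symm _ σ) hvP))

/-- In an admissible state the anchor is not deleted on both sides. -/
theorem not_mem_D_of_mem_D2 (σ : State E T₁ T₂) (hadm : Z.adm σ) (h2 : k ∈ Z.D2 σ) : k ∉ Z.D σ := by
  intro h1
  obtain ⟨m, hmP, hmM⟩ := (Z.mem_D2_iff_inter k σ).1 h2
  exact Set.disjoint_left.1 hadm hmM (reach_singleton_subset h1 hmP)

/-- `G1` forces the anchor to be non-deleted (`REACH` of a deleted anchor is empty). -/
theorem not_mem_D_of_G1 (σ : State E T₁ T₂) (h : Z.G1 {k} σ) : k ∉ Z.D σ := by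
  intro hk
  obtain ⟨v, hvR, _⟩ := h
  obtain ⟨s, ⟨hs, hsD⟩, _⟩ := hvR
  rw [Set.mem_singleton_iff] at hs
  subst hs
  exact hsD hk

/-- Admissibility read on side `2`: no blocker is deleted on side `2`. -/
theorem adm_iff_disjoint_Bl_D2 (σ : State E T₁ T₂) : Z.adm σ ↔ Disjoint (Z.Bl σ) (Z.D2 σ) := by
  unfold adm D D2
  constructor
  · intro h
    rw [Set.disjoint_left]
    intro b hb hbD2
    obtain ⟨m, hm, hmb⟩ := exists_mem_reach_of_mem_reach (Z.adj_symm _ σ) hbD2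
    exact Set.disjoint_left.1 h hm (reach_singleton_subset (subset_reach hb) hmb)
  · intro h
    rw [Set.disjoint_left]
    intro m hm hmD
    obtain ⟨b, hb, hbm⟩ := exists_mem_reach_of_mem_reach (Z.adj_symm _ σ) hmD
    exact Set.disjoint_left.1 h hb (reach_singleton_subset (subset_reach hm) hbm)

section Sets

variable [Fintype E] [DecidableEq E] [Fintype T₁] [DecidableEq T₁] [Fintype T₂] [DecidableEq T₂]

open Classical in
/-- `F`: the admissible states whose anchor sub-zone is all red (the anchor deleted on neither side). -/
noncomputable def Fset : Finset (State E T₁ T₂) := univ.filter fun σ => Z.adm σ ∧ k ∉ Z.D σ ∧ k ∉ Z.D2 σ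

open Classical in
/-- `T₁`: the admissible states whose anchor sub-zone is of type `1` (carries a blue `1`-edge). -/
noncomputable def T1set : Finset (State E T₁ T₂) := univ.filter fun σ => Z.adm σ ∧ k ∈ Z.D σ

open Classical in
/-- `T₂`: the admissible states whose anchor sub-zone is of type `2` (carries a blue `2`-edge). -/
noncomputable def T2set : Finset (State E T₁ T₂) := univ.filter fun σ => Z.adm σ ∧ k ∈ Z.D2 σ

open Classical in
/-- `I`: the invalid admissible states (every terminal edge at the red reach of the anchor blue). -/
noncomputable def Iset : Finset (State E T₁ T₂) := univ.filter fun σ => Z.adm σ ∧ Z.blueK {k} σ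

open Classical in
/-- The admissible states with `G1`. -/
noncomputable def G1set : Finset (State E T₁ T₂) := univ.filter fun σ => Z.adm σ ∧ Z.G1 {k} σ

open Classical in
/-- The admissible states with `G2`. -/
noncomputable def G2set : Finset (State E T₁ T₂) := univ.filter fun σ => Z.adm σ ∧ Z.G2 {k} σ

open Classical in
/-- The valid admissible states. -/
noncomputable def Vset : Finset (State E T₁ T₂) := univ.filter fun σ => Z.adm σ ∧ Z.Valid {k} σ

open Classical in
/-- The intermediate set of the first involution: admissible, anchor not deleted, a red `2`-edge on its sub-zone. -/
noncomputable def Xset : Finset (State E T₁ T₂) :=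
  univ.filter fun σ => Z.adm σ ∧ k ∉ Z.D σ ∧ (Z.P {k} σ ∩ Z.Mt σ).Nonempty

/-- Membership in the admissible states (`Q = ∅`). -/
theorem mem_Aset_empty {σ : State E T₁ T₂} : σ ∈ Z.Aset (∅ : Set V) ↔ Z.adm σ := by
  classical
  unfold Aset
  rw [Finset.mem_filter]
  exact ⟨fun h => h.2.1, fun h => ⟨Finset.mem_univ _, h, Z.gam_empty σ⟩⟩

/-- Membership in `F`. -/
theorem mem_Fset {σ : State E T₁ T₂} : σ ∈ Z.Fset k ↔ Z.adm σ ∧ k ∉ Z.D σ ∧ k ∉ Z.D2 σ := by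
  classical
  unfold Fset
  rw [Finset.mem_filter]
  exact and_iff_right (Finset.mem_univ _)

/-- Membership in `T₁`. -/
theorem mem_T1set {σ : State E T₁ T₂} : σ ∈ Z.T1set k ↔ Z.adm σ ∧ k ∈ Z.D σ := by
  classical
  unfold T1set
  rw [Finset.mem_filter]
  exact and_iff_right (Finset.mem_univ _)

/-- Membership in `T₂`. -/
theorem mem_T2set {σ : State E T₁ T₂} : σ ∈ Z.T2set k ↔ Z.adm σ ∧ k ∈ Z.D2 σ := by
  classical
  unfold T2set
  rw [Finset.mem_filter]
  exact and_iff_right (Finset.mem_univ _)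

/-- Membership in `I`. -/
theorem mem_Iset {σ : State E T₁ T₂} : σ ∈ Z.Iset k ↔ Z.adm σ ∧ Z.blueK {k} σ := by
  classical
  unfold Iset
  rw [Finset.mem_filter]
  exact and_iff_right (Finset.mem_univ _)

/-- Membership in `G1set`. -/
theorem mem_G1set {σ : State E T₁ T₂} : σ ∈ Z.G1set k ↔ Z.adm σ ∧ Z.G1 {k} σ := by
  classical
  unfold G1set
  rw [Finset.mem_filter]
  exact and_iff_right (Finset.mem_univ _)

/-- Membership in `G2set`. -/
theorem mem_G2set {σ : State E T₁ T₂} : σ ∈ Z.G2set k ↔ Z.adm σ ∧ Z.G2 {k} σ := by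
  classical
  unfold G2set
  rw [Finset.mem_filter]
  exact and_iff_right (Finset.mem_univ _)

/-- Membership in `Vset`. -/
theorem mem_Vset {σ : State E T₁ T₂} : σ ∈ Z.Vset k ↔ Z.adm σ ∧ Z.Valid {k} σ := by
  classical
  unfold Vset
  rw [Finset.mem_filter]
  exact and_iff_right (Finset.mem_univ _)

/-- Membership in `Xset`. -/
theorem mem_Xset {σ : State E T₁ T₂} :
    σ ∈ Z.Xset k ↔ Z.adm σ ∧ k ∉ Z.D σ ∧ (Z.P {k} σ ∩ Z.Mt σ).Nonempty := by
  classical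
  unfold Xset
  rw [Finset.mem_filter]
  exact and_iff_right (Finset.mem_univ _)

/-! ## The trichotomy: `#adm = #F + #T₁ + #T₂` -/

/-- The admissible states split into the three kinds. -/
theorem card_Aset_eq_count : #(Z.Aset (∅ : Set V)) = #(Z.Fset k) + #(Z.T1set k) + #(Z.T2set k) := by
  classical
  have h1 := Finset.card_filter_add_card_filter_not (s := Z.Aset (∅ : Set V)) fun σ => k ∈ Z.D σ
  have h2 := Finset.card_filter_add_card_filter_not
    (s := (Z.Aset (∅ : Set V)).filter fun σ => ¬ k ∈ Z.D σ) fun σ => k ∈ Z.D2 σ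
  have e1 : (Z.Aset (∅ : Set V)).filter (fun σ => k ∈ Z.D σ) = Z.T1set k := by
    ext σ
    rw [Finset.mem_filter, Z.mem_Aset_empty, Z.mem_T1set]
  have e2 : ((Z.Aset (∅ : Set V)).filter fun σ => ¬ k ∈ Z.D σ).filter (fun σ => k ∈ Z.D2 σ) = Z.T2set k := by
    ext σ
    rw [Finset.mem_filter, Finset.mem_filter, Z.mem_Aset_empty, Z.mem_T2set]
    constructor
    · rintro ⟨⟨h1, _⟩, h2⟩
      exact ⟨h1, h2⟩
    · rintro ⟨h1, h2⟩
      exact ⟨⟨h1, Z.not_mem_D_of_mem_D2 k σ h1 h2⟩, h2⟩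
  have e3 : ((Z.Aset (∅ : Set V)).filter fun σ => ¬ k ∈ Z.D σ).filter (fun σ => ¬ k ∈ Z.D2 σ) = Z.Fset k := by
    ext σ
    rw [Finset.mem_filter, Finset.mem_filter, Z.mem_Aset_empty, Z.mem_Fset]
    constructor
    · rintro ⟨⟨h1, h2⟩, h3⟩
      exact ⟨h1, h2, h3⟩
    · rintro ⟨h1, h2, h3⟩
      exact ⟨⟨h1, h2⟩, h3⟩
  rw [e1] at h1
  rw [e2, e3] at h2
  omega

/-- The valid and the invalid admissible states. -/
theorem card_Vset_add_card_Iset : #(Z.Vset k) + #(Z.Iset k) = #(Z.Aset (∅ : Set V)) := by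
  classical
  have h := Finset.card_filter_add_card_filter_not (s := Z.Aset (∅ : Set V)) fun σ => Z.Valid {k} σ
  have e1 : (Z.Aset (∅ : Set V)).filter (fun σ => Z.Valid {k} σ) = Z.Vset k := by
    ext σ
    rw [Finset.mem_filter, Z.mem_Aset_empty, Z.mem_Vset]
  have e2 : (Z.Aset (∅ : Set V)).filter (fun σ => ¬ Z.Valid {k} σ) = Z.Iset k := by
    ext σ
    rw [Finset.mem_filter, Z.mem_Aset_empty, Z.mem_Iset]
    unfold Valid
    rw [not_not]
  rw [e1, e2] at h
  exact h

end Sets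

end ZoneData

end ZoneZ

end PercRepro
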